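/-
Copyright: width seat `ym-line-sll-p4` (prover-ym-line-sll-p4-g0-0), route `SoftLoopLongLag`, crux `SoftLoopLagFloorToTorus`
(stmt-QuantumFields-22504), line `birth` — G-free brick for the inner-box engine statement E2 (`stub_innerDatumMeanSmoothG`) and for the
background term of E1b/S2b of the lead's E-architecture (T′ card v5, `Cruxes/ColdBoxSoftLoopLagFloor/Lines/birth.md`).
-/
import Summits.QuantumFields.YangMills.Theorems.SoftLoopLongLagDirichletLoopInductance
import Summits.QuantumFields.YangMills.Theorems.WeakCouplingRatesBulkDominatesColdBoxWMeanSmoothOfExpansion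

/-!
# Route `SoftLoopLongLag`, crux K′ `SoftLoopLagFloorToTorus` (stmt-QuantumFields-22504), line `birth`: the BACKGROUND FLUX of a
# boundary datum through an `R×R` square near the centre of the cold box — sup, unit-step gradient and squared-flux DRIFT bounds from the
# datum's energy (G-free)

In the one-scale expansion of the box kernel `boxKernelG ρ β H ζ` around the background of a crude-good datum (sibling route
`ColdBoxAllGroups`, interfaces `KernelMeanExpansionG` / `KernelCovExpansionG` of `Theorems/ColdBoxAllGroupsDefs.lean`), the datum enters the
Gaussian model only through the background circulation `F̄ = d₁ ψ̄` of one-colour Dirichlet data `ϑ` (`ψ̄ = glue ϑ (mean ϑ)`), whose interior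
sup and gradient bounds at depth `≍ H` in terms of the Dirichlet energy `E = formM … ϑ s` of any competitor `s` are the landed G-free
`dirBackground_interior_bounds` (`|F̄(x)| ≤ C√E/H²`, `|F̄(x+e_j) − F̄(x)| ≤ C√E/H³` within `H/8` of the centre).  For the soft LOOP observable
of this route the background enters through the **background flux** `Φ̄(x) = Σ_{p ∈ rectSurface x R R} F̄(p; 1, 2)` through the spanning
surface of the `R×R` square at `x` (written out, no new definition).  This file sums the interior bounds over the surface:

* `backgroundFlux_interior_bounds` — `|Φ̄(x)| ≤ R²·C√E/H²` and `|Φ̄(x + e_j) − Φ̄(x)| ≤ R²·C√E/H³` (`H ≥ 8`, surface within `H/8` of the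
  centre);
* `abs_backgroundFlux_sq_step_sub_le` — `|Φ̄(x + e_j)² − Φ̄(x)²| ≤ 2·R⁴·C²·E/H⁵`;
* `abs_backgroundFlux_sq_shift_sub_le` — telescoped over `t` unit steps in the time direction:
  **`|Φ̄(x + t e₀)² − Φ̄(x)²| ≤ t · 2R⁴C²E/H⁵`** — the «background loop-flux drift» of the K2/E2 map (card: background flux `≤ R²s`, drift
  `≤ R³s/H` over time `R`, `s² ≍ E/H⁴`), the second G-free input of the E2 reduction (inner datum mean smoothness of the loop sum ⇐ loop mean
  expansion ∧ flat Dirichlet loop variance (`…DirichletLoopInductance`) ∧ this drift);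
* `int_near_of_norm_sub_boxCentre_le` — the sup-norm form `‖y − boxCentre H‖ ≤ H/8` gives the integer form `8|y_m − H| ≤ H` used by
  `dirBackground_interior_bounds` (converse of the landed `norm_sub_boxCentre_le_of_int`).

G-free, β-free; no new definition; standard axioms.  HONEST LABEL: rung R2xi-G RECORD label (leaf `WeakCouplingRates.XiPow`, an UPPER bound on
the lattice mass gap); NOT the Clay mass gap; no summit statement is touched.

References: G. Lawler, V. Limic, *Random Walk: A Modern Introduction* (2010) §6.3 (interior estimates for discrete harmonic functions);
T. Balaban, CMP 89 (1983) §2 (background fields of small boundary data).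
-/

set_option autoImplicit false

noncomputable section

open Finset
open Literature.Probability.LatticeModels (Site)
open Literature.MathematicalPhysics.QuantumLattice (ZdPlaquette)
open Literature.MathematicalPhysics.QuantumFieldTheory
open Literature.MathematicalPhysics.QuantumFieldTheory.LatticeMaxwell
open Literature.MathematicalPhysics.QuantumFieldTheory.AxialGauge
open Literature.MathematicalPhysics.QuantumFieldTheory.LatticeChain
open Literature.MathematicalPhysics.QuantumFieldTheory.LatticeForm (d₁)
open Summit.QuantumFields.YangMills.Theorems.WeakCouplingRates

namespace Summit.QuantumFields.YangMills.Theorems.SoftLoopLongLag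

/-- From the sup-norm form `‖y − boxCentre H‖ ≤ H/8` to the integer form «`8|y_m − H| ≤ H` for every coordinate» (converse of
`norm_sub_boxCentre_le_of_int`). -/
theorem int_near_of_norm_sub_boxCentre_le {H : ℕ} {y : Site 4} (hy : ‖y - boxCentre H‖ ≤ (H : ℝ) / 8) :
    ∀ m : Fin 4, 8 * |y m - (H : ℤ)| ≤ (H : ℤ) := by
  intro m
  have h1 : ‖(y - boxCentre H) m‖ ≤ ‖y - boxCentre H‖ := norm_le_pi_norm _ m
  have h2 : ‖(y - boxCentre H) m‖ = |((y m : ℤ) : ℝ) - H| := by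
    simp only [Pi.sub_apply, boxCentre, Int.norm_eq_abs, Int.cast_sub, Int.cast_natCast]
  rw [h2] at h1
  have h3 : (8 : ℝ) * |((y m : ℤ) : ℝ) - H| ≤ H := by linarith
  have h4 : (((8 * |y m - (H : ℤ)| : ℤ)) : ℝ) ≤ ((H : ℤ) : ℝ) := by push_cast; exact h3
  exact_mod_cast h4

/-- The surface sum of the unit-step translate is the translated surface sum:
`Σ_{p ∈ S(x + v)} g(p.1) = Σ_{p ∈ S(x)} g(p.1 + v)`. -/
theorem sum_rectSurface_shift_fst (x v : Site 4) (R T : ℕ) (g : Site 4 → ℝ) :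
    ∑ p ∈ rectSurface (x + v) R T, g p.1 = ∑ p ∈ rectSurface x R T, g (p.1 + v) :=
  sum_rectSurface_shift x v R T (fun p => g p.1)

/-- **Interior sup and unit-step gradient bounds of the background FLUX through an `R×R` square, from the datum's energy** (G-free):
there is an absolute constant `C ≥ 0` (that of `dirBackground_interior_bounds`) such that for every `H ≥ 8`, every datum `θ`, every free
competitor `s`, every `R` and every base point `x` whose spanning surface `rectSurface x R R` is based within sup-distance `H/8` of
`boxCentre H`: `|Φ̄(x)| ≤ R²·C·√E/H²` and, for every direction `j`, `|Φ̄(x + e_j) − Φ̄(x)| ≤ R²·C·√E/H³`, where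
`Φ̄(x) = Σ_{p ∈ rectSurface x R R} (d₁ ψ̄)(p.1; 1, 2)`, `ψ̄ = glue θ (mean θ)`, `E = formM (· ∉ dirFreeEdges H) dirCorner (2H+3) θ s`. [folklore] -/
theorem backgroundFlux_interior_bounds :
    ∃ C : ℝ, 0 ≤ C ∧ ∀ (H : ℕ), 8 ≤ H →
      ∀ (θ : Literature.MathematicalPhysics.QuantumLattice.ZdEdge 4 → ℝ) (s : DirFree H → ℝ) (x : Site 4) (R : ℕ),
        (∀ p ∈ rectSurface x R R, ‖p.1 - boxCentre H‖ ≤ (H : ℝ) / 8) →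
          |∑ p ∈ rectSurface x R R,
              d₁ (fun z (i : Fin 4) => LatticeMaxwell.glue (pin := fun e => e ∉ dirFreeEdges H) dirCorner (2 * H + 3) θ
                (mean (fun e => e ∉ dirFreeEdges H) dirCorner (2 * H + 3) θ) (z, i)) p.1 1 2| ≤
            (R : ℝ) ^ 2 * (C * Real.sqrt (formM (fun e => e ∉ dirFreeEdges H) dirCorner (2 * H + 3) θ s) / (H : ℝ) ^ 2) ∧
          ∀ j : Fin 4,
            |(∑ p ∈ rectSurface (x + Pi.single j 1) R R,
                d₁ (fun z (i : Fin 4) => LatticeMaxwell.glue (pin := fun e => e ∉ dirFreeEdges H) dirCorner (2 * H + 3) θ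
                  (mean (fun e => e ∉ dirFreeEdges H) dirCorner (2 * H + 3) θ) (z, i)) p.1 1 2) -
              ∑ p ∈ rectSurface x R R,
                d₁ (fun z (i : Fin 4) => LatticeMaxwell.glue (pin := fun e => e ∉ dirFreeEdges H) dirCorner (2 * H + 3) θ
                  (mean (fun e => e ∉ dirFreeEdges H) dirCorner (2 * H + 3) θ) (z, i)) p.1 1 2| ≤
            (R : ℝ) ^ 2 * (C * Real.sqrt (formM (fun e => e ∉ dirFreeEdges H) dirCorner (2 * H + 3) θ s) / (H : ℝ) ^ 3) := by
  obtain ⟨C, hC0, hI⟩ := dirBackground_interior_bounds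
  refine ⟨C, hC0, fun H hH θ s x R hx => ?_⟩
  set F : Site 4 → ℝ := fun y => d₁ (fun z (i : Fin 4) =>
    LatticeMaxwell.glue (pin := fun e => e ∉ dirFreeEdges H) dirCorner (2 * H + 3) θ
      (mean (fun e => e ∉ dirFreeEdges H) dirCorner (2 * H + 3) θ) (z, i)) y 1 2 with hF
  set E : ℝ := formM (fun e => e ∉ dirFreeEdges H) dirCorner (2 * H + 3) θ s with hE
  have hH0 : (0 : ℝ) < H := by exact_mod_cast (show 0 < H by omega)
  have hcard : ((rectSurface x R R).card : ℝ) ≤ (R : ℝ) ^ 2 := by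
    have := card_rectSurface_le x R R
    calc ((rectSurface x R R).card : ℝ) ≤ ((R * R : ℕ) : ℝ) := by exact_mod_cast this
      _ = (R : ℝ) ^ 2 := by push_cast; ring
  have hsup : ∀ p ∈ rectSurface x R R, |F p.1| ≤ C * Real.sqrt E / (H : ℝ) ^ 2 := fun p hp =>
    (hI H hH θ s p.1 (int_near_of_norm_sub_boxCentre_le (hx p hp)) 1 2).1
  have hgrad : ∀ j : Fin 4, ∀ p ∈ rectSurface x R R, |F (p.1 + Pi.single j 1) - F p.1| ≤ C * Real.sqrt E / (H : ℝ) ^ 3 :=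
    fun j p hp => (hI H hH θ s p.1 (int_near_of_norm_sub_boxCentre_le (hx p hp)) 1 2).2 j
  refine ⟨?_, fun j => ?_⟩
  · show |∑ p ∈ rectSurface x R R, F p.1| ≤ (R : ℝ) ^ 2 * (C * Real.sqrt E / (H : ℝ) ^ 2)
    refine (abs_sum_le_sum_abs _ _).trans ((sum_le_card_nsmul _ _ _ hsup).trans ?_)
    rw [nsmul_eq_mul]
    exact mul_le_mul_of_nonneg_right hcard (by positivity)
  · show |(∑ p ∈ rectSurface (x + Pi.single j 1) R R, F p.1) - ∑ p ∈ rectSurface x R R, F p.1| ≤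
      (R : ℝ) ^ 2 * (C * Real.sqrt E / (H : ℝ) ^ 3)
    rw [sum_rectSurface_shift_fst, ← sum_sub_distrib]
    refine (abs_sum_le_sum_abs _ _).trans ((sum_le_card_nsmul _ _ _ (hgrad j)).trans ?_)
    rw [nsmul_eq_mul]
    exact mul_le_mul_of_nonneg_right hcard (by positivity)

/-- **Unit-step drift of the SQUARED background flux** (G-free): with the constant of `backgroundFlux_interior_bounds`, for `H ≥ 8` and a
base point `x` such that both spanning surfaces `S(x)` and `S(x + e_j)` are based within `H/8` of the centre,
`|Φ̄(x + e_j)² − Φ̄(x)²| ≤ 2·R⁴·C²·E/H⁵` (`|b² − a²| ≤ |b − a|·(|a| + |b|)`). [folklore] -/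
theorem abs_backgroundFlux_sq_step_sub_le :
    ∃ C : ℝ, 0 ≤ C ∧ ∀ (H : ℕ), 8 ≤ H →
      ∀ (θ : Literature.MathematicalPhysics.QuantumLattice.ZdEdge 4 → ℝ) (s : DirFree H → ℝ) (x : Site 4) (R : ℕ) (j : Fin 4),
        (∀ p ∈ rectSurface x R R, ‖p.1 - boxCentre H‖ ≤ (H : ℝ) / 8) →
        (∀ p ∈ rectSurface (x + Pi.single j 1) R R, ‖p.1 - boxCentre H‖ ≤ (H : ℝ) / 8) →
          |(∑ p ∈ rectSurface (x + Pi.single j 1) R R,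
              d₁ (fun z (i : Fin 4) => LatticeMaxwell.glue (pin := fun e => e ∉ dirFreeEdges H) dirCorner (2 * H + 3) θ
                (mean (fun e => e ∉ dirFreeEdges H) dirCorner (2 * H + 3) θ) (z, i)) p.1 1 2) ^ 2 -
            (∑ p ∈ rectSurface x R R,
              d₁ (fun z (i : Fin 4) => LatticeMaxwell.glue (pin := fun e => e ∉ dirFreeEdges H) dirCorner (2 * H + 3) θ
                (mean (fun e => e ∉ dirFreeEdges H) dirCorner (2 * H + 3) θ) (z, i)) p.1 1 2) ^ 2| ≤
            2 * (R : ℝ) ^ 4 * C ^ 2 * formM (fun e => e ∉ dirFreeEdges H) dirCorner (2 * H + 3) θ s / (H : ℝ) ^ 5 := by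
  obtain ⟨C, hC0, hB⟩ := backgroundFlux_interior_bounds
  refine ⟨C, hC0, fun H hH θ s x R j hx hxj => ?_⟩
  set E : ℝ := formM (fun e => e ∉ dirFreeEdges H) dirCorner (2 * H + 3) θ s with hE
  have hH0 : (0 : ℝ) < H := by exact_mod_cast (show 0 < H by omega)
  have hE0 : 0 ≤ E := by rw [hE, formM]; exact Finset.sum_nonneg fun p _ => sq_nonneg _
  have ha := (hB H hH θ s x R hx).1
  have hb := (hB H hH θ s (x + Pi.single j 1) R hxj).1
  have hab := (hB H hH θ s x R hx).2 j
  refine (abs_sq_sub_sq_le ha hb hab).trans (le_of_eq ?_)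
  have hs : Real.sqrt E * Real.sqrt E = E := Real.mul_self_sqrt hE0
  rw [← hs]
  field_simp
  ring

/-- **Background loop-flux DRIFT over `t` time steps** (G-free; the background input of E2 `stub_innerDatumMeanSmoothG`): with the constant
of `backgroundFlux_interior_bounds`, for `H ≥ 8` and a base point `x` such that the spanning surfaces `S(x + i e₀)`, `i ≤ t`, are all based
within `H/8` of the centre, `|Φ̄(x + t e₀)² − Φ̄(x)²| ≤ t · 2R⁴C²E/H⁵` (telescoping `abs_backgroundFlux_sq_step_sub_le`). [folklore] -/
theorem abs_backgroundFlux_sq_shift_sub_le :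
    ∃ C : ℝ, 0 ≤ C ∧ ∀ (H : ℕ), 8 ≤ H →
      ∀ (θ : Literature.MathematicalPhysics.QuantumLattice.ZdEdge 4 → ℝ) (s : DirFree H → ℝ) (x : Site 4) (R t : ℕ),
        (∀ i : ℕ, i ≤ t → ∀ p ∈ rectSurface (x + Pi.single 0 (i : ℤ)) R R, ‖p.1 - boxCentre H‖ ≤ (H : ℝ) / 8) →
          |(∑ p ∈ rectSurface (x + Pi.single 0 (t : ℤ)) R R,
              d₁ (fun z (i : Fin 4) => LatticeMaxwell.glue (pin := fun e => e ∉ dirFreeEdges H) dirCorner (2 * H + 3) θ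
                (mean (fun e => e ∉ dirFreeEdges H) dirCorner (2 * H + 3) θ) (z, i)) p.1 1 2) ^ 2 -
            (∑ p ∈ rectSurface x R R,
              d₁ (fun z (i : Fin 4) => LatticeMaxwell.glue (pin := fun e => e ∉ dirFreeEdges H) dirCorner (2 * H + 3) θ
                (mean (fun e => e ∉ dirFreeEdges H) dirCorner (2 * H + 3) θ) (z, i)) p.1 1 2) ^ 2| ≤
            (t : ℝ) * (2 * (R : ℝ) ^ 4 * C ^ 2 * formM (fun e => e ∉ dirFreeEdges H) dirCorner (2 * H + 3) θ s / (H : ℝ) ^ 5) := by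
  obtain ⟨C, hC0, hS⟩ := abs_backgroundFlux_sq_step_sub_le
  refine ⟨C, hC0, fun H hH θ s x R t hnear => ?_⟩
  -- the squared flux along the time axis, as an opaque sequence `B`
  obtain ⟨B, hB⟩ : ∃ B : ℕ → ℝ, ∀ i : ℕ, B i = (∑ p ∈ rectSurface (x + Pi.single 0 (i : ℤ)) R R,
      d₁ (fun z (i : Fin 4) => LatticeMaxwell.glue (pin := fun e => e ∉ dirFreeEdges H) dirCorner (2 * H + 3) θ
        (mean (fun e => e ∉ dirFreeEdges H) dirCorner (2 * H + 3) θ) (z, i)) p.1 1 2) ^ 2 := ⟨_, fun _ => rfl⟩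
  obtain ⟨D, hD⟩ : ∃ D : ℝ, D = 2 * (R : ℝ) ^ 4 * C ^ 2 *
      formM (fun e => e ∉ dirFreeEdges H) dirCorner (2 * H + 3) θ s / (H : ℝ) ^ 5 := ⟨_, rfl⟩
  have hstep : ∀ i : ℕ, i + 1 ≤ t → |B (i + 1) - B i| ≤ D := by
    intro i hi
    have hx1 : x + Pi.single 0 (((i + 1 : ℕ) : ℤ)) = x + Pi.single 0 (i : ℤ) + Pi.single 0 1 := by
      rw [Nat.cast_succ, Pi.single_add, add_assoc]
    have h0 := hS H hH θ s (x + Pi.single 0 (i : ℤ)) R 0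
    have h1 := hnear i (by omega)
    have h1' := hnear (i + 1) hi
    rw [hx1] at h1'
    have h2 := h0 (fun p hp => h1 p (by simpa using hp)) (fun p hp => h1' p (by simpa using hp))
    rw [hB (i + 1), hB i, hD, hx1]
    exact h2
  have htel : |B t - B 0| ≤ (t : ℝ) * D := by
    rw [← Finset.sum_range_sub B t]
    refine (abs_sum_le_sum_abs _ _).trans ?_
    calc ∑ i ∈ Finset.range t, |B (i + 1) - B i| ≤ ∑ _i ∈ Finset.range t, D :=
          Finset.sum_le_sum fun i hi => hstep i (by have := Finset.mem_range.1 hi; omega)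
      _ = (t : ℝ) * D := by rw [Finset.sum_const, Finset.card_range, nsmul_eq_mul]
  have hx0 : x + Pi.single 0 ((0 : ℕ) : ℤ) = x := by simp
  have hBt := hB t
  have hB0 := hB 0
  rw [hx0] at hB0
  rw [← hBt, ← hB0, ← hD]
  exact htel

end Summit.QuantumFields.YangMills.Theorems.SoftLoopLongLag

end
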